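import Mathlib
import HarnessLib
import Literature.Probability.LatticeModels.TorusFourierWeightedConvolution
import Summits.HubbardSuperconductivity.HubbardSuperconductivity.Theorems.KLProgrammeKLRegimeEngineFrameShiftMomentResponse
import Summits.HubbardSuperconductivity.HubbardSuperconductivity.Theorems.KLProgrammeKLRegimeSplitSymInterpPureMoments
import Summits.HubbardSuperconductivity.HubbardSuperconductivity.Theorems.KLProgrammeKLRegimeCountertermMuFlow

/-!
# K3 gen-8-FLOW (stmt 20437 `KLRegimeEngineV17F2`, stub (C), door (B)): the READING step — momentum jets of the interpolated spin/frequency-averaged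
# real part of two-leg data from the weighted Fourier-`ℓ¹` moments of the complex data

Cell gate-hubbard-kl, seat p2 g11.  The local two-leg value is `k⃗ ↦ ¼Σ_σ[Re Fp(σ,k⃗) + Re Fm(σ,k⃗)]` (`klLocSelfEnergyRe`: `F_± = Σ_n((±ω₀,k⃗),σ)`), read through
the `C₄ᵥ`-symmetrised interpolant `symInterp L` (p1b's `norm_iteratedFDeriv_evalM_symInterp_le_pure_moments`: momentum jets ≤ PURE position moments of the
cosine coefficients).  Door (B) (`covResp_moment_kernel_two_sub_le`, `moment_selfEnergy_flowStep_sub_le`) delivers the moments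
`Σ_x (1+|x̃₀|+|x̃₁|)^r‖𝔉⁻¹[F](x)‖` of the COMPLEX data.  This file is the bridge, representation-agnostic (any `Fp, Fm : Fin 2 → (ℤ/L)² → ℂ`):

* `torusCosCoeff_locReAvg` — the cosine coefficients of the averaged real part are the average of the cosine coefficients of the real parts;
* `sum_momentWeight_abs_torusCosCoeff_locReAvg_le` — `Σ_x (1+|x̃₀|+|x̃₁|)^r·|(¼Σ_σ[Re Fp + Re Fm])_c(x)| ≤ ¼Σ_σ(M_r(F̌₊ σ) + M_r(F̌₋ σ))`
  (`sum_mul_abs_torusCosCoeff_re_le`, the weight is even);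
* **`norm_iteratedFDeriv_evalM_symInterp_locReAvg_le`** — `‖Dʲ evalM (symInterp L (¼Σ_σ[Re Fp + Re Fm])) q‖ ≤ ¼Σ_σ(M_j(F̌₊ σ) + M_j(F̌₋ σ))`,
  `M_j(G) = Σ_x (1+|x̃₀|+|x̃₁|)^j‖𝔉⁻¹[G](x)‖` — so the RESPONSE of the reading's momentum jets is bounded by the sum over `(σ, ±)` of door (B)'s moments
  of the response data `F_±(σ,·) = Σ[𝒲₁]((±ω₀,·),σ) − Σ[𝒲₀]((±ω₀,·),σ)` (linearity of `Re`, of the average and of `symInterp`).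

Proofs only; nothing about the model is asserted.  References: BGM 2006 §2.3 (2.17), §2.4 (2.36) [cite: BenfattoGiulianiMastropietro2006].
-/

noncomputable section

namespace Summit.HubbardSuperconductivity.HubbardSuperconductivity.Theorems.EngineV8

set_option linter.dupNamespace false -- summit = problem name (single-conjunct summit), D-0017

open Finset Literature.MathematicalPhysics.QuantumLattice Literature.Probability.LatticeModels
open Summit.HubbardSuperconductivity.HubbardSuperconductivity.Theorems.KLRegimeSplit

variable {L : ℕ} [NeZero L]

/-- **Cosine coefficients of the averaged real part**: `(¼Σ_σ[Re Fp σ + Re Fm σ])_c(x) = ¼Σ_σ[(Re Fp σ)_c(x) + (Re Fm σ)_c(x)]`. -/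
theorem torusCosCoeff_locReAvg (Fp Fm : Fin 2 → TorusSite 2 L → ℂ) (x : TorusSite 2 L) :
    torusCosCoeff L (fun k => (∑ σ : Fin 2, ((Fp σ k).re + (Fm σ k).re)) / 4) x =
      (∑ σ : Fin 2, (torusCosCoeff L (fun k => (Fp σ k).re) x + torusCosCoeff L (fun k => (Fm σ k).re) x)) / 4 := by
  have hfun : (fun k => (∑ σ : Fin 2, ((Fp σ k).re + (Fm σ k).re)) / 4) =
      fun k => (1 / 4 : ℝ) * ((((Fp 0 k).re + (Fm 0 k).re)) + (((Fp 1 k).re + (Fm 1 k).re))) := by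
    funext k; rw [Fin.sum_univ_two]; ring
  rw [hfun, torusCosCoeff_const_mul, torusCosCoeff_add, torusCosCoeff_add, torusCosCoeff_add, Fin.sum_univ_two]
  ring

/-- **Weighted moments of the averaged real part's cosine coefficients** are bounded by the average of the weighted Fourier-`ℓ¹` moments of the complex
data: `Σ_x (1+|x̃₀|+|x̃₁|)^r·|(¼Σ_σ[Re Fp + Re Fm])_c(x)| ≤ ¼Σ_σ(Σ_x w‖F̌₊ σ‖ + Σ_x w‖F̌₋ σ‖)`. -/
theorem sum_momentWeight_abs_torusCosCoeff_locReAvg_le (Fp Fm : Fin 2 → TorusSite 2 L → ℂ) (r : ℕ) :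
    ∑ x : TorusSite 2 L, (1 + ((x 0).valMinAbs.natAbs : ℝ) + ((x 1).valMinAbs.natAbs : ℝ)) ^ r *
        |torusCosCoeff L (fun k => (∑ σ : Fin 2, ((Fp σ k).re + (Fm σ k).re)) / 4) x| ≤
      (∑ σ : Fin 2, ((∑ x : TorusSite 2 L, (1 + ((x 0).valMinAbs.natAbs : ℝ) + ((x 1).valMinAbs.natAbs : ℝ)) ^ r * ‖torusFourierInv (Fp σ) x‖) +
        (∑ x : TorusSite 2 L, (1 + ((x 0).valMinAbs.natAbs : ℝ) + ((x 1).valMinAbs.natAbs : ℝ)) ^ r * ‖torusFourierInv (Fm σ) x‖))) / 4 := by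
  set w : TorusSite 2 L → ℝ := fun x => (1 + ((x 0).valMinAbs.natAbs : ℝ) + ((x 1).valMinAbs.natAbs : ℝ)) ^ r with hw
  have hw0 : ∀ x, 0 ≤ w x := fun x => by rw [hw]; positivity
  have hwe : ∀ x, w (-x) = w x := fun x => by simp only [hw]; exact momentWeight₂_pow_neg r x
  have hre : ∀ (G : TorusSite 2 L → ℂ), ∑ x, w x * |torusCosCoeff L (fun k => (G k).re) x| ≤ ∑ x, w x * ‖torusFourierInv G x‖ :=
    fun G => sum_mul_abs_torusCosCoeff_re_le G hw0 hwe
  -- pointwise: the coefficient of the average is the average of the coefficients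
  have hpt : ∀ x, w x * |torusCosCoeff L (fun k => (∑ σ : Fin 2, ((Fp σ k).re + (Fm σ k).re)) / 4) x| ≤
      (∑ σ : Fin 2, (w x * |torusCosCoeff L (fun k => (Fp σ k).re) x| + w x * |torusCosCoeff L (fun k => (Fm σ k).re) x|)) / 4 := by
    intro x
    rw [torusCosCoeff_locReAvg, abs_div, abs_of_pos (by norm_num : (0 : ℝ) < 4), mul_div_assoc']
    refine div_le_div_of_nonneg_right ?_ (by norm_num)
    refine le_trans (mul_le_mul_of_nonneg_left (abs_sum_le_sum_abs _ _) (hw0 x)) ?_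
    rw [mul_sum]
    exact sum_le_sum fun σ _ => by
      calc w x * |torusCosCoeff L (fun k => (Fp σ k).re) x + torusCosCoeff L (fun k => (Fm σ k).re) x|
          ≤ w x * (|torusCosCoeff L (fun k => (Fp σ k).re) x| + |torusCosCoeff L (fun k => (Fm σ k).re) x|) :=
            mul_le_mul_of_nonneg_left (abs_add_le _ _) (hw0 x)
        _ = _ := by ring
  calc ∑ x, w x * |torusCosCoeff L (fun k => (∑ σ : Fin 2, ((Fp σ k).re + (Fm σ k).re)) / 4) x|
      ≤ ∑ x, (∑ σ : Fin 2, (w x * |torusCosCoeff L (fun k => (Fp σ k).re) x| + w x * |torusCosCoeff L (fun k => (Fm σ k).re) x|)) / 4 :=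
        sum_le_sum fun x _ => hpt x
    _ = (∑ σ : Fin 2, ((∑ x, w x * |torusCosCoeff L (fun k => (Fp σ k).re) x|) + ∑ x, w x * |torusCosCoeff L (fun k => (Fm σ k).re) x|)) / 4 := by
        rw [← sum_div, sum_comm]
        simp only [sum_add_distrib]
    _ ≤ (∑ σ : Fin 2, ((∑ x, w x * ‖torusFourierInv (Fp σ) x‖) + ∑ x, w x * ‖torusFourierInv (Fm σ) x‖)) / 4 :=
        div_le_div_of_nonneg_right (sum_le_sum fun σ _ => add_le_add (hre _) (hre _)) (by norm_num)

/-- **THE READING STEP**: the momentum jets of the interpolated averaged real part are bounded by the average of the weighted Fourier-`ℓ¹` moments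
(order `j`) of the complex data: `‖Dʲ evalM (symInterp L (¼Σ_σ[Re Fp + Re Fm])) q‖ ≤ ¼Σ_σ(M_j(F̌₊ σ) + M_j(F̌₋ σ))`. -/
theorem norm_iteratedFDeriv_evalM_symInterp_locReAvg_le (Fp Fm : Fin 2 → TorusSite 2 L → ℂ) (j : ℕ) (q : Momentum) :
    ‖iteratedFDeriv ℝ j (evalM (symInterp L (fun k => (∑ σ : Fin 2, ((Fp σ k).re + (Fm σ k).re)) / 4))) q‖ ≤
      (∑ σ : Fin 2, ((∑ x : TorusSite 2 L, (1 + ((x 0).valMinAbs.natAbs : ℝ) + ((x 1).valMinAbs.natAbs : ℝ)) ^ j * ‖torusFourierInv (Fp σ) x‖) +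
        (∑ x : TorusSite 2 L, (1 + ((x 0).valMinAbs.natAbs : ℝ) + ((x 1).valMinAbs.natAbs : ℝ)) ^ j * ‖torusFourierInv (Fm σ) x‖))) / 4 := by
  refine (norm_iteratedFDeriv_evalM_symInterp_le_pure_moments L _ j q).trans (le_trans (sum_le_sum fun x _ => ?_)
    (sum_momentWeight_abs_torusCosCoeff_locReAvg_le Fp Fm j))
  refine mul_le_mul_of_nonneg_right (pow_le_pow_left₀ (by positivity) ?_ j) (abs_nonneg _)
  linarith

end Summit.HubbardSuperconductivity.HubbardSuperconductivity.Theorems.EngineV8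

end
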